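import Literature.AlgebraicGeometry.HodgeTheory.WeilClassesMoonenZarhinCriterion
import Literature.AlgebraicGeometry.HodgeTheory.GlobalInvariantCycles
import Literature.AlgebraicGeometry.Motives.FamiliesVHS
import HarnessLib.Audit
import HarnessLib

/-!
# WeilTypeLadder · R3var — the VARIATIONAL rung for Weil classes of a CM field (conjecture leaf)

b2b cell `hweil` (packet `run/shared/lean/b2b/hodge-weil/`, LADDER.md §3 row R3var, CLAIM TABLE row P2;
analysis `b2b-hweil-pv2/COR-11-2-4.md`). ONE `@[conjecture]` definition, an obligation of
`HodgeConjecture/HodgeConjecture` (it is a CASE of the summit: on-path lemma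
`WeilTypeLadder.weilVariationalHodgeCMField_of_hodgeConjecture` in the sibling
`Theorems/WeilTypeLadderVariationalOnPath.lean`), in the conventions of the conjecture leaf
`Theorems/WeilTypeLadder.lean` (rung R3 `WeilClassesCMField`: `K = ℚ(φ) ≅ ℚ[T]/(P)` a CM field rendered on
the complex roots of `P`, Weil space `weilClassesField A φ P (2m) = W_K ⊗ ℂ`,
`HodgeTheory/WeilClassesMoonenZarhinCriterion`) and of the route crux `HeckePrymWeil.WeilVariationalHodge`
(stmt-HodgeConjecture-14497; families `Motives.IsSmoothProjectiveFamily`, fibres `fiberOver`, restrictions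
`complexBetti.map (fiberι f s)`, a GLOBAL class `W` on the total space standing for a flat section — Deligne's
partie fixe, tree `deligne_globalInvariantCycles`) in its Weil-transport shape `WT(p, M)`
(`Theorems/HeckePrymWeilWeilVariationalHodgeWeilTransport.lean`: a chart `e′ : A′.X ≅ 𝒳_s` of an abelian
variety carrying the class into the Weil space), with the base/total-space hypotheses every base-side engine of
the tree requires (`IsQuasiProjectiveOver 𝒳`, `IsQuasiProjectiveOver S`, `Smooth S.hom`, `IrreducibleSpace`:
`charlesSchnell_algebraicityLocus_iUnion_closed_holds`, `Andre1996_deformation`; lesson of leads c0–c3 of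
stmt-14497, `Cruxes/WeilVariationalHodge/Lines/Sketch-dead.md` §3, §5).

WHAT IT TYPES. E. Markman, *Secant sheaves on abelian n-folds with real multiplication and Weil classes on
abelian 2n-folds with complex multiplication*, arXiv:2509.23079 (2025, UNREFEREED), §11.2 (held text, chunk
33), verbatim: "The following Corollary is an immediate consequence of Proposition 11.2.2. It is the reduction
of the algebraicity of the Weil classes on abelian varieties with complex multiplication to the variational
Hodge conjecture. Let `(A, η′, h′)` be a polarized abelian variety of Weil type parametrized by the same
connected component of the period domain `Ω_B` corresponding to `(X × X̂, η, h)` […] **Corollary 11.2.4.**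
Assume that the class `c` is algebraic. If the flat deformation of the algebraic class `κ_{d/2}(φ̌(c))` in
`H^d(X × X̂, ℚ)` remains algebraic in `H^d(A, ℚ)`, then every class in `HW(A, η′)` is algebraic." The
hypothesis "the flat deformation … remains algebraic" is an instance of Grothendieck's variational Hodge
conjecture (Publ. IHÉS 29 (1966), footnote 13; Charles–Schnell, *Notes on absolute Hodge classes* (2014),
Conj. 11.3.1, p. 477: "`S` a smooth connected complex quasi-projective variety, `π : 𝒳 → S` a smooth
projective morphism […] `α` is the cohomology class of some codimension `p` algebraic cycle `Z₀`, and […]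
extends as a section `α̃` of the local system `R^{2p}π_*ℚ(p)` on `S`. […] For any complex point `s` of `S`,
the class `α̃_s` is the cohomology class of an algebraic cycle") with: base = an algebraic model of the
connected component of the period domain of polarized abelian `de/2`-folds of Weil type with multiplication by
the CM field `K` (`e = [K:ℚ]`, `d = dim_K H¹`), degree `2p = d` — NOT the middle degree unless `e = 2` —,
anchor `X × X̂`, class a secant-sheaf class whose flat transport stays in `𝔄^d ⊇ HW` (Prop. 11.2.2, Thm.
1.1.2). Markman's objects (`Φ`, `B`, `κ`, `Ω_B`) are not in the tree and the corollary is unrefereed, so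
neither is vendored (cell rule: no internally-minted statement enters as a cited fact); what IS typed here is
the VHC instance with the anchor ABSTRACTED and the class confined to the Weil space, i.e. the statement every
engine (semiregularity: Buchweitz–Flenner 2003 Thm. 5.1 / Pridham / Perry 2026, tree facts
`BuchweitzFlenner2003_variationalHodge_semiregular`, `Perry2026_semiregular_remainsAlgebraic`) would have to
deliver for Cor. 11.2.4 to bite, uniformly in the CM field:

* `WeilVariationalHodgeCMField` (R3var): for `P ∈ ℤ[T]` monic irreducible of degree `e` cutting out a CM field
  (no real root; ONE `Q ∈ ℚ[T]` inducing complex conjugation on all roots — Charles–Schnell Def. 11.5.2) and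
  `m ≥ 1`: along every smooth projective family `f : 𝒳 ⟶ S` of relative dimension `e·m` (`= de/2`,
  `d = 2m`) with quasi-projective `𝒳`, `S` and `S` smooth irreducible, every global class
  `W ∈ H^{2m}(𝒳(ℂ); ℂ)` whose restriction to each fibre is rational of Hodge type `(m, m)` and is carried by
  a chart `e′ : A′.X ≅ 𝒳_s` (an abelian variety `A′` with `φ′`, `P(φ′) = 0`, `e · 2m = 2 dim A′`) into the
  Weil space `weilClassesField A′ φ′ P (2m)`, and which is algebraic on ONE fibre, is algebraic on EVERY fibre.

Relations (proved in the OnPath sibling): `HodgeConjecture → R3var`; the pointwise rung R3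
(`WeilClassesCMField`, `e > 2`) implies R3var for `e > 2` fibre by fibre (transport along the chart); for
`e = 2`, `P = T² + p` the route crux `HeckePrymWeil.WeilVariationalHodge` (all `(M,M)` classes, no
quasi-projectivity hypotheses) is STRONGER. The converse direction "R3var ⟹ R3-split" is Markman's Thm.
1.1.2 / Cor. 11.2.4 granted generic `B`-secant sheaves (companion Question 12.2.2) — print, unrefereed, not
typed. Nothing here is asserted; no `_holds` is in sight.
-/

-- every declaration of this problem lives in `Summit.HodgeConjecture.HodgeConjecture.…` (summit = sub-problem)
set_option linter.dupNamespace false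

noncomputable section

open CategoryTheory

namespace Summit.HodgeConjecture.HodgeConjecture.WeilTypeLadder

open Literature.AlgebraicGeometry Literature.AlgebraicGeometry.Motives
open Literature.AlgebraicGeometry.HodgeTheory
open Literature.AlgebraicTopology.SingularHomology

/-- **R3var — variational Hodge for the Weil classes of a CM field `K = ℚ(φ) ≅ ℚ[T]/(P)` along smooth
projective `K`-Weil families** (the variational-Hodge hypothesis of Markman, arXiv:2509.23079 Cor. 11.2.4 /
Thm. 1.1.2, with the secant-sheaf anchor abstracted to "algebraic on one fibre"; an instance of Grothendieck's
variational Hodge conjecture, Charles–Schnell Conj. 11.3.1, in the global-class / Weil-transport shape of the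
tree). Data: `P ∈ ℤ[T]` monic, irreducible over `ℚ`, of degree `e`, with no real complex root and ONE
`Q ∈ ℚ[T]` carrying every complex root to its conjugate (`K` is a CM field, C–S Def. 11.5.2); `m ≥ 1`;
`f : 𝒳 ⟶ S` a smooth projective family of relative dimension `e·m` with `𝒳`, `S` quasi-projective, `S`
smooth and irreducible; `W ∈ H^{2m}(𝒳(ℂ); ℂ)` with every fibre restriction `W|_{𝒳_s}` rational of Hodge type
`(m,m)` and carried by some chart `e′ : A′.X ≅ 𝒳_s` (`A′` abelian, `φ′ : A′ ⟶ A′`, `P(φ′) = 0`,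
`e·(2m) = 2·dim A′`) into `weilClassesField A′ φ′ P (2m) = W_K ⊗ ℂ`. Statement: if `W|_{𝒳_{s₀}}` is
algebraic for ONE complex point `s₀`, then `W|_{𝒳_s}` is algebraic for EVERY complex point `s`. OPEN (an
instance of VHC; HC-sandwiched like stmt-HodgeConjecture-14497); KNOWN for `e = 2`, `m ≤ 3` on split
components through genus-3 product points (Markman arXiv:2502.03415 Thm. 1.5.1 via semiregular secant
sheaves). A CASE of the summit (`WeilTypeLadder.weilVariationalHodgeCMField_of_hodgeConjecture`).
[cite: Markman2025SecantRealMultiplication, Cor. 11.2.4 and Thm. 1.1.2] [cite: CharlesSchnell2014Notes, Conj. 11.3.1 (p. 477)]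
[cite: Grothendieck1966, footnote 13] [status: open] -/
@[conjecture] def WeilVariationalHodgeCMField : Prop :=
  ∀ (P : Polynomial ℤ) (e m : ℕ), P.Monic → P.natDegree = e → Irreducible (P.map (Int.castRingHom ℚ)) →
    (∀ ρ : ℂ, Polynomial.eval₂ (Int.castRingHom ℂ) ρ P = 0 → starRingEnd ℂ ρ ≠ ρ) →
    (∃ Q : Polynomial ℚ, ∀ ρ : ℂ, Polynomial.eval₂ (Int.castRingHom ℂ) ρ P = 0 →
        Polynomial.eval₂ (algebraMap ℚ ℂ) ρ Q = starRingEnd ℂ ρ) →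
    1 ≤ m →
    ∀ ⦃𝒳 S : Motives.SchemeOver ℂ⦄ (f : 𝒳 ⟶ S), Motives.IsSmoothProjectiveFamily f (e * m) →
      IsQuasiProjectiveOver 𝒳 → IsQuasiProjectiveOver S → IrreducibleSpace S.left →
      AlgebraicGeometry.Smooth S.hom →
      ∀ (W : complexBetti 𝒳 (2 * m)),
        (∀ s : Motives.ComplexPoints S,
          IsRationalClass (complexBetti.map (Motives.fiberι f s) (2 * m) W) ∧
            IsOfHodgeType (e * m) (Motives.fiberOver f s) (2 * m) m m
              (complexBetti.map (Motives.fiberι f s) (2 * m) W)) →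
        (∀ s : Motives.ComplexPoints S, ∃ (A' : Motives.AbelianVariety ℂ) (φ' : A' ⟶ A')
            (e' : A'.X ≅ Motives.fiberOver f s),
          Polynomial.eval₂ (Int.castRingHom (CategoryTheory.End A')) (φ' : CategoryTheory.End A') P = 0 ∧
            e * (2 * m) = 2 * A'.dim ∧
            complexBetti.map e'.hom (2 * m) (complexBetti.map (Motives.fiberι f s) (2 * m) W) ∈
              weilClassesField A' φ' P (2 * m)) →
        (∃ s₀ : Motives.ComplexPoints S,
          complexBetti.map (Motives.fiberι f s₀) (2 * m) W ∈
            algebraicClasses (Motives.fiberOver f s₀) m) →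
        ∀ s : Motives.ComplexPoints S,
          complexBetti.map (Motives.fiberι f s) (2 * m) W ∈ algebraicClasses (Motives.fiberOver f s) m

end Summit.HodgeConjecture.HodgeConjecture.WeilTypeLadder

end
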